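import Mathlib.MeasureTheory.Measure.MeasureSpace
import Mathlib.Analysis.SpecialFunctions.Exp
import Mathlib.Analysis.SpecificLimits.Basic
import Mathlib.Topology.Instances.ENNReal.Lemmas
import Summits.AtomisticToContinuum.HydrodynamicLimit.Theorems.RelayRaceLocalityNearConstantShortTimeHLDiagonal
import HarnessLib

/-!
# Crux `NearConstantShortTimeHL` (stmt-AtomisticToContinuum-12502), line `small-tilt-domination` — good-event extraction

Lead c4, helper of `stub_gronwallAssembly`, step (3) of the relative-entropy Grönwall assembly: the GOOD-EVENT EXTRACTION.
Data: the true laws `P N`, invariant reference laws `G N` with the EVENT IMPORT `P N A ≤ e^{a n_N} · G N A` (tilt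
domination), finitely many (`q < Q i`) closure-defect events `E i q N` of grid size `i`, each of `G`-probability
`≤ e^{-c₀ n_N}` eventually in `N`, a rate gap `a < c₀`, cap-failure events `B N` of `P`-probability `→ 0`, and side
conditions `p i N` valid eventually in `N` for each fixed `i`.
`exists_goodEvents_of_import`: there is a diagonal grid index `ι(N) → ∞` (from the landed `exists_diagonal_index`) with
`p (ι N) N` eventually, and MEASURABLE good events `G' N` of `P`-probability `→ 1` avoiding `B N` and every indexed defect
event `E (ι N) q N`, `q < Q (ι N)`.  The bad set `B N ∪ ⋃_{q < Q (ι N)} E (ι N) q N` has `P`-mass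
`≤ P N (B N) + Q (ι N) · e^{(a - c₀) n_N} ≤ P N (B N) + 1/(ι N + 1) → 0`; `G' N` is the complement of its measurable hull.
All estimates live in `ℝ≥0∞`; no finiteness of the measures is used.
-/

namespace Summit.AtomisticToContinuum.HydrodynamicLimit.Theorems.NearConstantShortTimeHL

open scoped BigOperators ENNReal
open MeasureTheory Set Filter

/-- **Rate gap.** For a fixed count `Q` and rates `a < c₀`, `Q · (e^{a n_N} · e^{-c₀ n_N}) → 0` along any
`n_N → ∞`. [folklore] -/
theorem xg_tendsto_count_mul_exp_zero {n : ℕ → ℕ} (hn : Tendsto n atTop atTop) {a c₀ : ℝ} (hac : a < c₀)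
    (Q : ℝ) : Tendsto (fun N => Q * (Real.exp (a * n N) * Real.exp (-(c₀ * n N)))) atTop (nhds 0) := by
  have h1 : Tendsto (fun N => (a - c₀) * (n N : ℝ)) atTop atBot :=
    (tendsto_natCast_atTop_atTop.comp hn).const_mul_atTop_of_neg (sub_neg.2 hac)
  have h2 : Tendsto (fun N => Real.exp ((a - c₀) * (n N : ℝ))) atTop (nhds 0) :=
    Real.tendsto_exp_atBot.comp h1
  have h3 : (fun N => Q * (Real.exp (a * n N) * Real.exp (-(c₀ * n N)))) =
      fun N => Q * Real.exp ((a - c₀) * (n N : ℝ)) := by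
    funext N
    rw [← Real.exp_add]
    congr 2
    ring
  rw [h3]
  simpa using h2.const_mul Q

/-- **Good-event extraction.** Under the event import `P N A ≤ e^{a n_N} G N A`, `G`-exponential smallness
`G N (E i q N) ≤ e^{-c₀ n_N}` (eventually, for each fixed grid index `i` and each of the `Q i` defect events) with
`a < c₀`, side conditions `p i N` valid eventually for each fixed `i`, and cap failures `P N (B N) → 0`, there are a
diagonal index `ι(N) → ∞` with `p (ι N) N` eventually and measurable good events `G' N` with `P N (G' N)ᶜ → 0`,
`G' N ⊆ (B N)ᶜ` and `G' N ⊆ (E (ι N) q N)ᶜ` for all `q < Q (ι N)`. [folklore] -/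
theorem exists_goodEvents_of_import : ∀ {Ω : ℕ → Type*} [∀ N, MeasurableSpace (Ω N)]
    (P G : (N : ℕ) → MeasureTheory.Measure (Ω N)) (n : ℕ → ℕ), Filter.Tendsto n Filter.atTop Filter.atTop →
    ∀ {a c₀ : ℝ}, a < c₀ →
    (∀ N (A : Set (Ω N)), P N A ≤ ENNReal.ofReal (Real.exp (a * n N)) * G N A) →
    ∀ (Q : ℕ → ℕ) (E : (i q N : ℕ) → Set (Ω N)),
    (∀ i, ∀ q < Q i, ∀ᶠ N in Filter.atTop, G N (E i q N) ≤ ENNReal.ofReal (Real.exp (-(c₀ * n N)))) →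
    ∀ (p : ℕ → ℕ → Prop), (∀ i, ∀ᶠ N in Filter.atTop, p i N) →
    ∀ (B : (N : ℕ) → Set (Ω N)), Filter.Tendsto (fun N => P N (B N)) Filter.atTop (nhds 0) →
    ∃ ι : ℕ → ℕ, Filter.Tendsto ι Filter.atTop Filter.atTop ∧ (∀ᶠ N in Filter.atTop, p (ι N) N) ∧
      ∃ G' : (N : ℕ) → Set (Ω N), (∀ N, MeasurableSet (G' N)) ∧
        Filter.Tendsto (fun N => P N (G' N)ᶜ) Filter.atTop (nhds 0) ∧
        ∀ᶠ N in Filter.atTop, G' N ⊆ (B N)ᶜ ∧ ∀ q < Q (ι N), G' N ⊆ (E (ι N) q N)ᶜ := by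
  intro Ω _ P G n hn a c₀ hac himp Q E hE p hp B hB
  -- (1) the combined eventual property for each FIXED index `i`
  have hcomb : ∀ i, ∀ᶠ N in atTop, p i N ∧
      (∀ q ∈ Finset.range (Q i), G N (E i q N) ≤ ENNReal.ofReal (Real.exp (-(c₀ * n N)))) ∧
      (Q i : ℝ) * (Real.exp (a * n N) * Real.exp (-(c₀ * n N))) ≤ 1 / ((i : ℝ) + 1) := by
    intro i
    refine (hp i).and (((Finset.range (Q i)).eventually_all.2 fun q hq =>
      hE i q (Finset.mem_range.1 hq)).and ?_)
    have h0 : (0 : ℝ) < 1 / ((i : ℝ) + 1) := by positivity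
    exact (xg_tendsto_count_mul_exp_zero hn hac (Q i)).eventually_le_const h0
  -- (2) the diagonal index
  obtain ⟨ι, hι, hιp⟩ := exists_diagonal_index hcomb
  -- (3) bad sets and good events
  let B' : (N : ℕ) → Set (Ω N) := fun N => B N ∪ ⋃ q ∈ Finset.range (Q (ι N)), E (ι N) q N
  let G' : (N : ℕ) → Set (Ω N) := fun N => (toMeasurable (P N) (B' N))ᶜ
  refine ⟨ι, hι, hιp.mono fun N hN => hN.1, G', fun N => (measurableSet_toMeasurable _ _).compl, ?_, ?_⟩
  · -- (4)-(5) `P N (G' N)ᶜ = P N (B' N) ≤ P N (B N) + 1/(ι N + 1) → 0`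
    have hbound : ∀ᶠ N in atTop, P N (G' N)ᶜ ≤ P N (B N) + ENNReal.ofReal (1 / ((ι N : ℝ) + 1)) := by
      filter_upwards [hιp] with N hN
      obtain ⟨_, hGE, hsmall⟩ := hN
      have h1 : P N (G' N)ᶜ = P N (B' N) := by
        show P N (toMeasurable (P N) (B' N))ᶜᶜ = P N (B' N)
        rw [compl_compl, measure_toMeasurable]
      rw [h1]
      calc P N (B' N) ≤ P N (B N) + P N (⋃ q ∈ Finset.range (Q (ι N)), E (ι N) q N) :=
            measure_union_le _ _
        _ ≤ P N (B N) + ∑ q ∈ Finset.range (Q (ι N)), P N (E (ι N) q N) := by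
          gcongr
          exact measure_biUnion_finset_le _ _
        _ ≤ P N (B N) + ∑ q ∈ Finset.range (Q (ι N)),
            ENNReal.ofReal (Real.exp (a * n N)) * ENNReal.ofReal (Real.exp (-(c₀ * n N))) := by
          gcongr with q hq
          calc P N (E (ι N) q N) ≤ ENNReal.ofReal (Real.exp (a * n N)) * G N (E (ι N) q N) := himp N _
            _ ≤ _ := by
              gcongr
              exact hGE q hq
        _ = P N (B N) + ENNReal.ofReal ((Q (ι N) : ℝ) * (Real.exp (a * n N) * Real.exp (-(c₀ * n N)))) := by
          rw [Finset.sum_const, Finset.card_range, nsmul_eq_mul, ENNReal.ofReal_mul (Nat.cast_nonneg _),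
            ENNReal.ofReal_natCast, ENNReal.ofReal_mul (Real.exp_pos _).le]
        _ ≤ P N (B N) + ENNReal.ofReal (1 / ((ι N : ℝ) + 1)) := by
          gcongr
    have hlim : Tendsto (fun N => P N (B N) + ENNReal.ofReal (1 / ((ι N : ℝ) + 1))) atTop (nhds 0) := by
      have h1 : Tendsto (fun N => ENNReal.ofReal (1 / ((ι N : ℝ) + 1))) atTop (nhds 0) := by
        have := ENNReal.tendsto_ofReal ((tendsto_one_div_add_atTop_nhds_zero_nat (𝕜 := ℝ)).comp hι)
        simpa using this
      simpa using hB.add h1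
    exact tendsto_of_tendsto_of_tendsto_of_le_of_le' tendsto_const_nhds hlim
      (Eventually.of_forall fun _ => zero_le) hbound
  · -- avoidance (valid for every `N`)
    refine Eventually.of_forall fun N => ?_
    have hsub : G' N ⊆ (B' N)ᶜ := compl_subset_compl.2 (subset_toMeasurable _ _)
    refine ⟨hsub.trans (compl_subset_compl.2 subset_union_left), fun q hq =>
      hsub.trans (compl_subset_compl.2 (subset_union_of_subset_right ?_ _))⟩
    exact Set.subset_iUnion₂ (s := fun q (_ : q ∈ Finset.range (Q (ι N))) => E (ι N) q N) q
      (Finset.mem_range.2 hq)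

end Summit.AtomisticToContinuum.HydrodynamicLimit.Theorems.NearConstantShortTimeHL
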